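import Summits.Ventures.PercRepro.ProfileBiIndepShiftSup

/-!
# PercRepro — (Cons) BY DEGREES: BELOW A THIRD OF THE GROUND SET THE CONSECUTIVE CONTAINMENT MATCHING `BI_j → BI_{j+1}` EXISTS
(p10, gen 26; unconditional)

A bi-independent `j`-set has at least `n − 2j` bi-independent one-element extensions (gen 13's `card_ext_ge`), a bi-independent
`(j+1)`-set at most `j + 1` bi-independent `j`-subsets.  So for every family `𝒜 ⊆ BI_j` the double count gives
`#𝒜·(n − 2j) ≤ #N(𝒜)·(j + 1)` (`card_mul_le_card_bipartite_succ`), and when `3j + 1 ≤ n` Hall's condition `#𝒜 ≤ #N(𝒜)` holds: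
**`exists_injOn_biIndepSets_succ_of_three_mul`** — an injection `f : BI_j → BI_{j+1}` with `X ⊆ f X` for `3j + 1 ≤ n` (Mathlib's
Hall theorem), hence `card_biIndepSets_le_succ_of_three_mul`: Theorem A's unnormalised step `P_j ≤ P_{j+1}` for `3j + 1 ≤ n`,
unconditionally (the normalised step `(n − j)·P_j ≤ (j + 1)·P_{j+1}` in that regime is gen 13's `sum_extCount_ge` +
`sum_extCount_eq`).  The conjecture (Cons) is the same matching for `2j + 2 ≤ n`; the regime `3j + 1 ≤ n` is where degrees alone
decide.  Nothing here asserts (Cons).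
-/

open scoped Matroid

namespace PercRepro.Cogirth

open Finset ThmH Skew

variable {α : Type} [DecidableEq α] {M : Matroid α} [M.Finite]

/-- The bi-independent `(j+1)`-supersets of the members of a family `𝒜 ⊆ BI_j`. -/
noncomputable def succNbrs (M : Matroid α) [M.Finite] (𝒜 : Finset (Finset α)) (j : ℕ) : Finset (Finset α) :=
  (biIndepSets M (j + 1)).filter (fun Y => ∃ X ∈ 𝒜, X ⊆ Y)

/-- **The degree count**: `#𝒜·(n − 2j) ≤ #N(𝒜)·(j + 1)` for `𝒜 ⊆ BI_j`. -/
theorem card_mul_le_card_bipartite_succ {j : ℕ} {𝒜 : Finset (Finset α)} (h𝒜 : 𝒜 ⊆ biIndepSets M j) :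
    𝒜.card * ((gr M).card - 2 * j) ≤ (succNbrs M 𝒜 j).card * (j + 1) := by
  classical
  refine card_mul_le_card_mul (fun X Y => X ⊆ Y) ?_ ?_
  · intro X hX
    have hXb : X ∈ biIndepSets M j := h𝒜 hX
    have hXg : X ⊆ gr M := (mem_biIndepSets.1 hXb).1
    have himg : ((gr M).filter (fun p => p ∉ X ∧ insert p X ∈ biIndepSets M (j + 1))).image (fun p => insert p X) ⊆
        (succNbrs M 𝒜 j).bipartiteAbove (fun X Y => X ⊆ Y) X := by
      intro Y hY
      rw [mem_image] at hY
      obtain ⟨p, hp, rfl⟩ := hY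
      rw [mem_filter] at hp
      rw [mem_bipartiteAbove]
      refine ⟨?_, subset_insert _ _⟩
      unfold succNbrs
      rw [mem_filter]
      exact ⟨hp.2.2, X, hX, subset_insert _ _⟩
    have hinj : Set.InjOn (fun p => insert p X)
        ((gr M).filter (fun p => p ∉ X ∧ insert p X ∈ biIndepSets M (j + 1)) : Finset α) := by
      intro a ha b hb hab
      simp only at hab
      rw [mem_coe, mem_filter] at ha hb
      have : a ∈ insert b X := hab ▸ mem_insert_self a X
      rw [mem_insert] at this
      rcases this with h | h
      · exact h
      · exact absurd h ha.2.1
    calc (gr M).card - 2 * j ≤ ((gr M).filter (fun p => p ∉ X ∧ insert p X ∈ biIndepSets M (j + 1))).card :=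
          card_ext_ge hXb
      _ = (((gr M).filter (fun p => p ∉ X ∧ insert p X ∈ biIndepSets M (j + 1))).image (fun p => insert p X)).card :=
          (card_image_of_injOn hinj).symm
      _ ≤ ((succNbrs M 𝒜 j).bipartiteAbove (fun X Y => X ⊆ Y) X).card := card_le_card himg
  · intro Y hY
    have hYc : Y.card = j + 1 := by
      unfold succNbrs at hY
      rw [mem_filter] at hY
      exact (mem_biIndepSets.1 hY.1).2.1
    have hsub : 𝒜.bipartiteBelow (fun X Y => X ⊆ Y) Y ⊆ Y.image (fun a => Y.erase a) := by
      intro X hX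
      rw [mem_bipartiteBelow] at hX
      obtain ⟨hX𝒜, hXY⟩ := hX
      have hXj : X.card = j := (mem_biIndepSets.1 (h𝒜 hX𝒜)).2.1
      obtain ⟨a, haY, haX⟩ : ∃ a ∈ Y, a ∉ X := by
        by_contra hcon
        have hYX : Y ⊆ X := fun y hy => by
          by_contra h
          exact hcon ⟨y, hy, h⟩
        have := card_le_card hYX
        omega
      rw [mem_image]
      refine ⟨a, haY, ?_⟩
      symm
      apply eq_of_subset_of_card_le
      · intro x hx
        rw [mem_erase]
        exact ⟨fun h => haX (h ▸ hx), hXY hx⟩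
      · rw [card_erase_of_mem haY, hYc, hXj]
        omega
    calc (𝒜.bipartiteBelow (fun X Y => X ⊆ Y) Y).card ≤ (Y.image (fun a => Y.erase a)).card := card_le_card hsub
      _ ≤ Y.card := card_image_le
      _ = j + 1 := hYc

/-- Hall's condition for the consecutive containment graph when `3j + 1 ≤ n`. -/
theorem card_le_card_succNbrs_of_three_mul {j : ℕ} (hj : 3 * j + 1 ≤ (gr M).card) {𝒜 : Finset (Finset α)}
    (h𝒜 : 𝒜 ⊆ biIndepSets M j) : 𝒜.card ≤ (succNbrs M 𝒜 j).card := by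
  have h := card_mul_le_card_bipartite_succ h𝒜
  have h2 : 𝒜.card * (j + 1) ≤ 𝒜.card * ((gr M).card - 2 * j) := Nat.mul_le_mul_left _ (by omega)
  exact Nat.le_of_mul_le_mul_right (h2.trans h) (Nat.succ_pos j)

/-- **THE CONSECUTIVE CONTAINMENT MATCHING EXISTS BELOW A THIRD OF THE GROUND SET** (unconditional): for `3j + 1 ≤ n` there is
an injection `f` on `BI_j` with `X ⊆ f X ∈ BI_{j+1}` (Mathlib's Hall theorem on the degree count). -/
theorem exists_injOn_biIndepSets_succ_of_three_mul {j : ℕ} (hj : 3 * j + 1 ≤ (gr M).card) :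
    ∃ f : Finset α → Finset α, Set.InjOn f (biIndepSets M j) ∧
      ∀ X ∈ biIndepSets M j, f X ∈ biIndepSets M (j + 1) ∧ X ⊆ f X := by
  let T : Finset (Finset α) := biIndepSets M (j + 1)
  let t : {X // X ∈ biIndepSets M j} → Finset (Finset α) := fun X => T.filter (fun Y => X.1 ⊆ Y)
  have hall : ∀ s : Finset {X // X ∈ biIndepSets M j}, s.card ≤ (s.biUnion t).card := by
    intro s
    have h1 := card_le_card_succNbrs_of_three_mul hj (𝒜 := s.map (Function.Embedding.subtype _)) (by
      intro X hX
      rw [mem_map] at hX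
      obtain ⟨Y, _, rfl⟩ := hX
      exact Y.2)
    rw [card_map] at h1
    refine h1.trans (card_le_card ?_)
    intro Y hY
    unfold succNbrs at hY
    rw [mem_filter] at hY
    obtain ⟨hYT, X, hX, hXY⟩ := hY
    rw [mem_map] at hX
    obtain ⟨Z, hZ, rfl⟩ := hX
    rw [mem_biUnion]
    refine ⟨Z, hZ, ?_⟩
    simp only [t, mem_filter]
    exact ⟨hYT, hXY⟩
  obtain ⟨f, hfinj, hft⟩ := (all_card_le_biUnion_card_iff_existsInjective' t).1 hall
  refine ⟨fun X => if hX : X ∈ biIndepSets M j then f ⟨X, hX⟩ else X, ?_, ?_⟩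
  · intro X hX Y hY hXY
    have hX' : X ∈ biIndepSets M j := hX
    have hY' : Y ∈ biIndepSets M j := hY
    dsimp only at hXY
    rw [dif_pos hX', dif_pos hY'] at hXY
    exact congrArg Subtype.val (hfinj hXY)
  · intro X hX
    dsimp only
    rw [dif_pos hX]
    have h1 := hft ⟨X, hX⟩
    simp only [t, mem_filter] at h1
    exact h1

/-- Theorem A's unnormalised step `P_j ≤ P_{j+1}` for `3j + 1 ≤ n`, unconditionally, by the injection. -/
theorem card_biIndepSets_le_succ_of_three_mul {j : ℕ} (hj : 3 * j + 1 ≤ (gr M).card) :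
    (biIndepSets M j).card ≤ (biIndepSets M (j + 1)).card := by
  obtain ⟨f, hinj, hf⟩ := exists_injOn_biIndepSets_succ_of_three_mul (M := M) hj
  exact card_le_card_of_injOn f (fun X hX => (hf X hX).1) hinj

end PercRepro.Cogirth
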